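import Mathlib.GroupTheory.OrderOfElement
import Mathlib.GroupTheory.SpecificGroups.Cyclic
import Mathlib.NumberTheory.Padics.PadicVal.Basic
import Mathlib.RingTheory.Coprime.Lemmas
import Mathlib.Data.Int.GCD
import HarnessLib

/-!
# Crux `PrintCf2.SplitBadTwoRankOneOfFacts` (stmt-BirchSwinnertonDyer-20368), road α v10.3 — S3c (R-BV) factor (F1), piece (A):
# THE KERNEL OF A HOMOMORPHISM ON A PRÜFER LINE `Q = ⋃ ℤ·g_N` HAS ORDER `p^D`, `D` = THE LAST LEVEL KILLED

Cell `bsd-print-cf2`, width seat `bsd-line-cf2-p1-w6` g3 (prover-bsd-line-cf2-p1-w6-g3-0). `--supports stmt-BirchSwinnertonDyer-20368`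
(helper, Theses-free, GENERIC group theory). HONEST FRAMING: nothing here closes the crux or a registered stub; BSD is not proved by any of
this; no summit statement is proved by this seat. No definition, no named fact, no `sorry`.

WHAT. The displayed factor (F1) of (R-BV) (LEAD cut 13 `restrictedControl_two_of_ptFacts_factor_values … (hF1) …`) is
`v₂ #(Q_M ⊓ ker loc_{v̄}) = ℓ + e₁([d]₂)`. By p674334 (`exists_comap_kummer_eq_zsmul_of_frame`) `Q_M = ⋃_N ℤ·g_N` with the KUMMER TOWER
`g_N = e_* res_⊤ κ_N(P_K)`, `p • g_{N+1} = g_N`, `p^N g_N = 0`; the local pieces (B)–(D) + (L2) (p675150) say `loc_{v̄} g_N = 0 ⟺ N ≤ D` with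
`D = ℓ − [d ≡ 3 (8)]`. THIS FILE is the abstract group theory turning that into the COUNT: for a tower `g : ℕ → A` in an abelian group
(`p • g (N+1) = g N`, `p^N • g N = 0`), a subgroup `Q` exhausted by the integer multiples of the `g_N` and containing them, and a homomorphism
`f : A → B` with `f (g N) = 0 ⟺ N ≤ D`:
* `pow_smul_tower` (`p^j • g (N + j) = g N`), `eq_zero_of_zsmul_eq_zero_of_pow_smul_eq_zero` (`k • y = 0`, `p^m • y = 0`, `p ∤ k` ⟹ `y = 0`);
* **`inf_ker_eq_zmultiples`** — `Q ⊓ ker f = ℤ·g_D` (induction on the level: `p ∣ k` descends a level, `p ∤ k` forces `f (g N) = 0`);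
* `addOrderOf_tower` — `g 1 ≠ 0 ⟹ addOrderOf (g N) = p^N`; **`natCard_inf_ker_eq`** — `#(Q ⊓ ker f) = p^D`;
  **`padicValNat_natCard_inf_ker_eq`** — `v_p #(Q ⊓ ker f) = D`.
presearch: elementary (subgroups of `ℚ_p/ℤ_p`); Mathlib `Nat.card_zmultiples`, `addOrderOf_eq_prime_pow`; nothing to cite beyond folklore;
no Literature fact filed. beyond-print theorem: no.

References: [SerreGaloisCohomology1997] I §2 (for the consumer); folklore (finite subgroups of a Prüfer group are the `ℤ·g_D`).
-/

set_option linter.dupNamespace false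
set_option autoImplicit false

namespace Summit.BirchSwinnertonDyer.BirchSwinnertonDyer.Theorems.PrintCf2.RestrictedSelmerPair

variable {A B : Type*} [AddCommGroup A] [AddCommGroup B] {p : ℕ}

/-- Iterating the tower relation: `p^j • g (N + j) = g N`. [folklore] -/
theorem pow_smul_tower (g : ℕ → A) (hg : ∀ N, p • g (N + 1) = g N) (N j : ℕ) : p ^ j • g (N + j) = g N := by
  induction j with
  | zero => rw [pow_zero, one_smul, Nat.add_zero]
  | succ j ih => rw [pow_succ, mul_smul, ← Nat.add_assoc, hg, ih]

/-- Bézout: an element killed by an integer prime to `p` and by a power of `p` is zero. [folklore] -/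
theorem eq_zero_of_zsmul_eq_zero_of_pow_smul_eq_zero (hp : p.Prime) {y : B} {k : ℤ} (hk : ¬ (p : ℤ) ∣ k)
    (hky : k • y = 0) {m : ℕ} (hpy : p ^ m • y = 0) : y = 0 := by
  have hcop' : Nat.Coprime p k.natAbs := (Nat.Prime.coprime_iff_not_dvd hp).mpr fun h ↦ hk (Int.natCast_dvd.mpr h)
  have hcop1 : IsCoprime (p : ℤ) k :=
    Int.isCoprime_iff_gcd_eq_one.mpr (by rw [Int.gcd_eq_natAbs, Int.natAbs_natCast]; exact hcop')
  have hcop : IsCoprime ((p : ℤ) ^ m) k := hcop1.pow_left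
  obtain ⟨a, b, hab⟩ := hcop
  calc y = (1 : ℤ) • y := (one_zsmul y).symm
    _ = (a * (p : ℤ) ^ m + b * k) • y := by rw [hab]
    _ = a • ((p ^ m : ℕ) : ℤ) • y + b • k • y := by rw [add_zsmul, mul_zsmul, mul_zsmul, Nat.cast_pow]
    _ = 0 := by rw [natCast_zsmul, hpy, hky, zsmul_zero, zsmul_zero, add_zero]

/-- **The kernel of `f` on the Prüfer line is `ℤ·g_D`.** For a tower `g` (`p • g (N+1) = g N`, `p^N • g N = 0`), a subgroup `Q`
exhausted by and containing the integer multiples of the `g N`, and a homomorphism `f` with `f (g N) = 0 ⟺ N ≤ D`: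
`Q ⊓ ker f = ℤ·g_D`. [folklore] -/
theorem inf_ker_eq_zmultiples (hp : p.Prime) (g : ℕ → A) (hg : ∀ N, p • g (N + 1) = g N) (hg0 : ∀ N, p ^ N • g N = 0)
    (Q : AddSubgroup A) (hQ : ∀ q ∈ Q, ∃ (N : ℕ) (k : ℤ), q = k • g N) (hgQ : ∀ N, g N ∈ Q)
    (f : A →+ B) {D : ℕ} (hD : ∀ N, f (g N) = 0 ↔ N ≤ D) :
    Q ⊓ f.ker = AddSubgroup.zmultiples (g D) := by
  -- every level-`N` multiple killed by `f` is a multiple of `g D`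
  have key : ∀ (N : ℕ) (k : ℤ), f (k • g N) = 0 → k • g N ∈ AddSubgroup.zmultiples (g D) := by
    intro N
    induction N with
    | zero =>
      intro k _
      have h0 : g 0 = 0 := by rw [← hg0 0, pow_zero, one_smul]
      rw [h0, zsmul_zero]
      exact zero_mem _
    | succ N ih =>
      intro k hk
      by_cases hle : N + 1 ≤ D
      · have hgD : g (N + 1) = p ^ (D - (N + 1)) • g D := by
          rw [← pow_smul_tower g hg (N + 1) (D - (N + 1)), Nat.add_sub_cancel' hle]
        rw [hgD, ← natCast_zsmul]
        exact AddSubgroup.zsmul_mem _ (AddSubgroup.zsmul_mem _ (AddSubgroup.mem_zmultiples _) _) _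
      · by_cases hdvd : (p : ℤ) ∣ k
        · obtain ⟨k₁, rfl⟩ := hdvd
          have hdesc : ((p : ℤ) * k₁) • g (N + 1) = k₁ • g N := by
            rw [mul_comm, mul_zsmul, natCast_zsmul, hg]
          rw [hdesc] at hk ⊢
          exact ih k₁ hk
        · exfalso
          refine hle ((hD (N + 1)).mp ?_)
          have h1 : k • f (g (N + 1)) = 0 := by rw [← map_zsmul]; exact hk
          have h2 : p ^ (N + 1) • f (g (N + 1)) = 0 := by rw [← map_nsmul, hg0, map_zero]
          exact eq_zero_of_zsmul_eq_zero_of_pow_smul_eq_zero hp hdvd h1 h2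
  ext q
  simp only [AddSubgroup.mem_inf, AddMonoidHom.mem_ker]
  constructor
  · rintro ⟨hq, hfq⟩
    obtain ⟨N, k, rfl⟩ := hQ q hq
    exact key N k hfq
  · intro hq
    obtain ⟨m, rfl⟩ := AddSubgroup.mem_zmultiples_iff.mp hq
    refine ⟨AddSubgroup.zsmul_mem _ (hgQ D) m, ?_⟩
    rw [map_zsmul, (hD D).mpr le_rfl, zsmul_zero]

/-- **Orders along the tower**: if `g 1 ≠ 0` then `addOrderOf (g N) = p^N` (`p^(N−1) • g N = g 1 ≠ 0`, `p^N • g N = 0`).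
[folklore] -/
theorem addOrderOf_tower [hp : Fact p.Prime] (g : ℕ → A) (hg : ∀ N, p • g (N + 1) = g N) (hg0 : ∀ N, p ^ N • g N = 0)
    (hg1 : g 1 ≠ 0) (N : ℕ) : addOrderOf (g N) = p ^ N := by
  cases N with
  | zero =>
    have h0 : g 0 = 0 := by rw [← hg0 0, pow_zero, one_smul]
    rw [h0, addOrderOf_zero, pow_zero]
  | succ N =>
    refine addOrderOf_eq_prime_pow (fun h ↦ hg1 ?_) (hg0 (N + 1))
    rw [← pow_smul_tower g hg 1 N, Nat.add_comm]
    exact h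

/-- **`#(Q ⊓ ker f) = p^D`** on the Prüfer line (`inf_ker_eq_zmultiples` + `Nat.card_zmultiples` + `addOrderOf_tower`). [folklore] -/
theorem natCard_inf_ker_eq [Fact p.Prime] (g : ℕ → A) (hg : ∀ N, p • g (N + 1) = g N) (hg0 : ∀ N, p ^ N • g N = 0)
    (hg1 : g 1 ≠ 0) (Q : AddSubgroup A) (hQ : ∀ q ∈ Q, ∃ (N : ℕ) (k : ℤ), q = k • g N) (hgQ : ∀ N, g N ∈ Q)
    (f : A →+ B) {D : ℕ} (hD : ∀ N, f (g N) = 0 ↔ N ≤ D) :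
    Nat.card ↥(Q ⊓ f.ker) = p ^ D := by
  rw [inf_ker_eq_zmultiples (Fact.out) g hg hg0 Q hQ hgQ f hD, Nat.card_zmultiples, addOrderOf_tower g hg hg0 hg1 D]

/-- **`v_p #(Q ⊓ ker f) = D`** on the Prüfer line. [folklore] -/
theorem padicValNat_natCard_inf_ker_eq [hp : Fact p.Prime] (g : ℕ → A) (hg : ∀ N, p • g (N + 1) = g N)
    (hg0 : ∀ N, p ^ N • g N = 0) (hg1 : g 1 ≠ 0) (Q : AddSubgroup A) (hQ : ∀ q ∈ Q, ∃ (N : ℕ) (k : ℤ), q = k • g N)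
    (hgQ : ∀ N, g N ∈ Q) (f : A →+ B) {D : ℕ} (hD : ∀ N, f (g N) = 0 ↔ N ≤ D) :
    padicValNat p (Nat.card ↥(Q ⊓ f.ker)) = D := by
  rw [natCard_inf_ker_eq g hg hg0 hg1 Q hQ hgQ f hD, padicValNat.prime_pow]

/-- The same with `Finite`: the kernel part of the line is finite (of order `p^D`). [folklore] -/
theorem finite_inf_ker [Fact p.Prime] (g : ℕ → A) (hg : ∀ N, p • g (N + 1) = g N) (hg0 : ∀ N, p ^ N • g N = 0)
    (hg1 : g 1 ≠ 0) (Q : AddSubgroup A) (hQ : ∀ q ∈ Q, ∃ (N : ℕ) (k : ℤ), q = k • g N) (hgQ : ∀ N, g N ∈ Q)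
    (f : A →+ B) {D : ℕ} (hD : ∀ N, f (g N) = 0 ↔ N ≤ D) :
    Finite ↥(Q ⊓ f.ker) :=
  Nat.finite_of_card_ne_zero (by
    rw [natCard_inf_ker_eq g hg hg0 hg1 Q hQ hgQ f hD]; exact pow_ne_zero _ (Fact.out : p.Prime).ne_zero)

end Summit.BirchSwinnertonDyer.BirchSwinnertonDyer.Theorems.PrintCf2.RestrictedSelmerPair
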